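import Summits.CriticalPhenomena.CardyFormulaZ2.Theses.CardySelfDualSegment
import Summits.CriticalPhenomena.CardyFormulaZ2.Theorems.CardyMagicRigidityLoopsToCrossingsStubComparisonGeometry
import Summits.CriticalPhenomena.CardyFormulaZ2.Theorems.CardyMagicRigidityLoopsToCrossingsStubCardyContinuity
import Literature.Probability.Percolation.CornerPercolation
import Literature.Probability.Percolation.CardyFormulaConformalInvariance
import Literature.Probability.Percolation.TriCrossingSandwich
import Literature.Probability.LatticeModels.TriangularLatticeProofs
import Literature.Probability.RandomPlanarGeometry.ImageUnivalent
import Literature.Probability.RandomPlanarGeometry.CollarGeometry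
import Literature.Barriers.CriticalPhenomena.EmbeddingModulusUniquenessProofs

/-!
# Crux `SmirnovBasePoint` (stmt-CriticalPhenomena-5474), line `Sketch`: stub `stub_bondRealisation`

Bond realisation of open-owner paths. Corner percolation `M_0` is site percolation on the
triangular lattice `triGraph` (vertex set `ℤ²`, `x ∼ y` iff `x, y` are `ℤ²`-neighbours or
`y = x ± (1, -1)`) drawn as bonds of `ℤ²`: the bond configuration `upTriangleConfig ω` opens
exactly the east edge `{v, v + e₀}` and the north edge `{v, v + e₁}` of every open site `v ∈ ω`.

We show that a `triGraph`-path of open sites inside `T` is realised by an open bond path of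
`upTriangleConfig ω` all of whose vertices are open sites of `T` or apexes `x + e₀`, `x + e₁` of
such sites:

* a step `x → x + eᵢ` uses the edge `{x, x + eᵢ}` of the corner of `x` (open since `x ∈ ω`), a
  step `x → x - eᵢ` the edge of the corner of `x - eᵢ`;
* the diagonal step `x → y = x + (1, -1)` goes `x → x + e₀ → y` (east edge of `x`, then the north
  edge of `y`, as `y + e₁ = x + e₀`), through the apex `x + e₀`;
* the diagonal step `x → y = x - (1, -1)` goes `x → x + e₁ → y` (north edge of `x`, then the east
  edge of `y`, as `y + e₀ = x + e₁`), through the apex `x + e₁`.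

Source: Bollobás–Riordan 2010 §2 (the model `M_0` / `H(p)` as site percolation on the triangular
lattice of corners); the path bookkeeping is folklore.
-/

noncomputable section

namespace Summit.CriticalPhenomena.CardyFormulaZ2.Cruxes.SmirnovBasePoint.ShearedSandwich

open Literature.Probability.RandomPlanarGeometry hiding cardyFunction
open Literature.Probability.Percolation hiding cardyFunction
open Literature.Probability.LatticeModels
open Literature.Barriers.CriticalPhenomena
open Summit.CriticalPhenomena.CardyFormulaZ2.Cruxes.LoopsToCrossings.OracleSandwich
open Filter Topology Set MeasureTheory Metric

namespace BondRealisation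

/-- In the bond picture `upTriangleConfig ω` of a site configuration `ω`, the edge `{v, v + eᵢ}` of
the corner of an open site `v ∈ ω` is an edge of the open graph. [folklore] -/
theorem adj_add_single {ω : SiteConfig (Site 2)} {v : Site 2} (hv : v ∈ ω) (i : Fin 2) :
    (openGraph (upTriangleConfig ω)).Adj v (v + Pi.single i 1) := by
  rw [openGraph_adj]
  refine ⟨(cornerEdge_mem_upTriangleConfig_iff ω (v, i)).2 hv, fun h => ?_⟩
  have h' := congrFun h i
  simp only [Pi.add_apply, Pi.single_eq_same] at h'
  omega

/-- `x + (1, -1) + e₁ = x + e₀` in `ℤ²`. [folklore] -/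
theorem add_triDiag_add_single_one (x : Site 2) :
    x + triDiag + Pi.single 1 1 = x + Pi.single 0 1 := by
  funext j
  fin_cases j <;> simp

/-- **One step.** Two `triGraph`-adjacent open sites `p, q` of `T` are joined by an open bond path
of `upTriangleConfig ω` through open sites of `T` and apexes `x + e₀`, `x + e₁` of such sites
(a diagonal step passes through one apex). [folklore] -/
theorem step {ω : SiteConfig (Site 2)} {T : Set (Site 2)} {p q : Site 2}
    (hp : p ∈ T ∩ ω) (hq : q ∈ T ∩ ω) (hpq : triGraph.Adj p q) :
    PathIn (openGraph (upTriangleConfig ω))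
      {w : Site 2 | w ∈ T ∩ ω ∨ ∃ x ∈ T ∩ ω, w = x + ![1, 0] ∨ w = x + ![0, 1]} p q := by
  set W : Set (Site 2) :=
    {w : Site 2 | w ∈ T ∩ ω ∨ ∃ x ∈ T ∩ ω, w = x + ![1, 0] ∨ w = x + ![0, 1]}
  have hpW : p ∈ W := Or.inl hp
  have hqW : q ∈ W := Or.inl hq
  rcases (triGraph_adj_iff p q).1 hpq with h | h | h
  · -- a nearest-neighbour step of `ℤ²`
    obtain ⟨i, rfl | rfl⟩ := (zdGraph_adj_iff p q).1 h
    · exact PathIn.of_adj hpW hqW (adj_add_single hp.2 i)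
    · exact PathIn.of_adj hpW hqW (adj_add_single hq.2 i).symm
  · -- `q = p + (1, -1)`: through the apex `p + e₀`
    subst h
    have hmid : p + Pi.single 0 1 ∈ W := Or.inr ⟨p, hp, Or.inl (by rw [vec10_eq_single])⟩
    have h2 : (openGraph (upTriangleConfig ω)).Adj (p + Pi.single 0 1) (p + triDiag) := by
      have h' := (adj_add_single hq.2 1).symm
      rwa [add_triDiag_add_single_one] at h'
    exact (PathIn.of_adj hpW hmid (adj_add_single hp.2 0)).tail h2 hqW
  · -- `p = q + (1, -1)`: through the apex `p + e₁ = q + e₀`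
    subst h
    have hmid : q + triDiag + Pi.single 1 1 ∈ W :=
      Or.inr ⟨q + triDiag, hp, Or.inr (by rw [vec01_eq_single])⟩
    have h2 : (openGraph (upTriangleConfig ω)).Adj (q + triDiag + Pi.single 1 1) q := by
      rw [add_triDiag_add_single_one]
      exact (adj_add_single hq.2 0).symm
    exact (PathIn.of_adj hpW hmid (adj_add_single hp.2 1)).tail h2 hqW

end BondRealisation

/-- **Stub B1 (bond realisation of open-owner paths).** A `𝕋`-path of open sites inside `T` is
realised by an open bond path of `upTriangleConfig ω` whose vertices are sites of `T ∩ ω` or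
apexes `x + e₀`, `x + e₁` of such sites (a diagonal step `x → x + (1,-1)` goes through the apex
`x + e₀`). [folklore] -/
theorem stub_bondRealisation : ∀ (ω : SiteConfig (Site 2)) (T : Set (Site 2)) (a b : Site 2),
    PathIn triGraph (T ∩ ω) a b →
      PathIn (openGraph (upTriangleConfig ω))
        {w : Site 2 | w ∈ T ∩ ω ∨ ∃ x ∈ T ∩ ω, w = x + ![1, 0] ∨ w = x + ![0, 1]} a b := by
  intro ω T a b h
  obtain ⟨ha, hr⟩ := h
  induction hr with
  | refl => exact PathIn.refl (Or.inl ha)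
  | tail hab hbc ih =>
    exact ih.trans (BondRealisation.step
      (PathIn.right_mem (show PathIn triGraph (T ∩ ω) a _ from ⟨ha, hab⟩)) hbc.2 hbc.1)

end Summit.CriticalPhenomena.CardyFormulaZ2.Cruxes.SmirnovBasePoint.ShearedSandwich
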